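import Mathlib
import HarnessLib
import Summits.HubbardSuperconductivity.HubbardSuperconductivity.Theorems.KLProgrammeKLRegimeSplitGlueP3
import Summits.HubbardSuperconductivity.HubbardSuperconductivity.Theorems.KLProgrammeKLRegimeSplitGlueP4
import Summits.HubbardSuperconductivity.HubbardSuperconductivity.Theorems.KLProgrammeKLRegimeSplitBundleV8

/-!
# Route `KLProgramme` — the K3-NAMED glue of the five children at the bundle `klPredsV8` (Δ16 count repair), in BOTH generic stagings:
# v4 (`EngineP4` / `VolumeLimitP2` with the regime-constant thresholds of Δ17, p1's `…SplitGenericV4` / `…SplitGlueP4`) and v3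
# (`EngineP3` / `VolumeLimitP`, `…SplitGenericV3` / `…SplitGlueP3`) (stmt-HubbardSuperconductivity-19937; DOWNSTREAM of the route file;
# cell gate-hubbard-kl, seat hubbard-kl-k3c2-p3)

`KLRegimeInductionV8P4 := KLRegimeInductionP4 klPredsV8 FinalTwoLegVolLimit` (p1 g6 17:0xZ spelling) — the closer the gen-3 resplit's glue item
cites in the `v8p4` staging (plan2 kit HOME/gate-hubbard-kl-plan2/kit/README-v8.md); `KLRegimeInductionV8P3 := KLRegimeInductionP3 klPredsV8
FinalTwoLegVolLimit` for the `v8p3` staging; `KLRegimeInductionV8P4_of_P3` (the v3 five-tuple closes K3 through the v4 glue).  Nothing else is asserted.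
-/

noncomputable section

namespace Summit.HubbardSuperconductivity.HubbardSuperconductivity.Theorems.KLRegimeSplit

set_option linter.dupNamespace false -- summit = problem name (single-conjunct summit), D-0017

/-- **The K3-named glue at `klPredsV8`, v4 staging** (regime-constant thresholds `c ≤ c₃` for the engine, `c ≤ c₅` for the volume limits):
the five children `EngineP4 klPredsV8 klWindowC`, `BetaSplitP klPredsV8 klWindowC`, `CountertermP2 klPredsV8 klWindowC`,
`VolumeLimitP2 klPredsV8 FinalTwoLegVolLimit klWindowC`, `TwoPointAssemblyP3 klPredsV8 FinalTwoLegVolLimit klWindowC` imply crux K3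
`KLRegimeTwoPointLimit` BY NAME. -/
theorem KLRegimeInductionV8P4 :
    EngineP4 klPredsV8 klWindowC → BetaSplitP klPredsV8 klWindowC → CountertermP2 klPredsV8 klWindowC →
      VolumeLimitP2 klPredsV8 FinalTwoLegVolLimit klWindowC → TwoPointAssemblyP3 klPredsV8 FinalTwoLegVolLimit klWindowC →
        Summit.HubbardSuperconductivity.HubbardSuperconductivity.Theses.KLProgramme.KLRegimeTwoPointLimit :=
  KLRegimeInductionP4 klPredsV8 FinalTwoLegVolLimit

/-- **The K3-named glue at `klPredsV8`, v3 staging**: the five children `EngineP3 klPredsV8 klWindowC`, `BetaSplitP klPredsV8 klWindowC`,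
`CountertermP2 klPredsV8 klWindowC`, `VolumeLimitP klPredsV8 FinalTwoLegVolLimit klWindowC`, `TwoPointAssemblyP3 klPredsV8 FinalTwoLegVolLimit klWindowC`
imply crux K3 `KLRegimeTwoPointLimit` BY NAME. -/
theorem KLRegimeInductionV8P3 :
    EngineP3 klPredsV8 klWindowC → BetaSplitP klPredsV8 klWindowC → CountertermP2 klPredsV8 klWindowC →
      VolumeLimitP klPredsV8 FinalTwoLegVolLimit klWindowC → TwoPointAssemblyP3 klPredsV8 FinalTwoLegVolLimit klWindowC →
        Summit.HubbardSuperconductivity.HubbardSuperconductivity.Theses.KLProgramme.KLRegimeTwoPointLimit :=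
  KLRegimeInductionP3 klPredsV8 FinalTwoLegVolLimit

/-- The v3 five-tuple at `klPredsV8` also closes K3 through the v4 glue (nothing proved on `EngineP3`/`VolumeLimitP` is lost). -/
theorem KLRegimeInductionV8P4_of_P3 :
    EngineP3 klPredsV8 klWindowC → BetaSplitP klPredsV8 klWindowC → CountertermP2 klPredsV8 klWindowC →
      VolumeLimitP klPredsV8 FinalTwoLegVolLimit klWindowC → TwoPointAssemblyP3 klPredsV8 FinalTwoLegVolLimit klWindowC →
        Summit.HubbardSuperconductivity.HubbardSuperconductivity.Theses.KLProgramme.KLRegimeTwoPointLimit :=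
  fun h₃ h₁ h₂ h₅ h₄ => KLRegimeInductionV8P4 (engineP4_of_engineP3 h₃) h₁ h₂ (volumeLimitP2_of_volumeLimitP h₅) h₄

end Summit.HubbardSuperconductivity.HubbardSuperconductivity.Theorems.KLRegimeSplit

end
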